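import Literature.Claims.NS.Petros2018
import HarnessLib

/-!
# Refutation of the first failing step of Petros (2018) (NS-claims census C83)

Claim file: `Literature.Claims.NS.Petros2018` (K. Petros, *Navier–Stokes equations — Millennium Prize
Problems*, 2018; typed skeleton `Literature/Claims/NS/Petros2018.lean`).

**Step refuted: Step 1 = `Literature.Claims.NS.Petros2018.Step_1_singlePhase`** (§2.1 (2.1.0)–(2.1.1)
p.129, vector form (2.2.1) p.130, used at (3.2.0) p.131): «Any periodic function in three dimensions can
be represented as the sum of cosine and sine series» in the SINGLE phase `2nπ A⃗·R⃗`, i.e. every smooth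
field invariant under the one translation `R ↦ R + A⃗` is a function of `A⃗·R⃗` alone.

**Countermodel.** Period vector `A⃗ = e₂`, datum `U₀(R) = cos(2π R₀) · e₁`: smooth, invariant under
`R ↦ R + e₂` (it does not depend on `R₂`), divergence free (`∂₁ cos(2π R₀) = 0`), orthogonal to `A⃗`
(the text's restriction (3.3.17)–(3.3.18)), but NOT a function of the phase `A⃗·R⃗ = R₂`: the points
`R = 0` and `R = ½ e₀` have the same phase `0` and the values `e₁ ≠ −e₁`.

Consequences recorded here: the same datum refutes the printed claimed statement
`Literature.Claims.NS.Petros2018.ClaimedTheorem` (through the skeleton's `singlePhase_of_claimed`: a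
single-phase solution at `t = 0` forces a single-phase datum), and the bridge
`Literature.Claims.NS.Petros2018.Step_bridge : ClaimedTheorem → clayPeriodic.Regularity` then holds
vacuously — the printed chain transmits nothing to the Clay periodic problem (B).

WHAT THIS IS NOT: not a statement about the Navier–Stokes problem itself; not about any author beyond
the typed locator. Pure calculus; no Navier–Stokes theory is used.
-/

set_option linter.dupNamespace false

namespace Summit.NavierStokesRegularity.NavierStokesRegularity.Theorems.Petros2018

open Real Literature.Analysis.FluidPDE Literature.Claims.NS.Petros2018
open scoped ContDiff

noncomputable section

/-- The period unit vector of the countermodel: `A⃗ = e₂ = (0, 0, 1)`. [folklore] -/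
def aVec : EuclideanSpace ℝ (Fin 3) := EuclideanSpace.single 2 1

/-- The direction of the countermodel datum: `e₁ = (0, 1, 0)`. [folklore] -/
def e1 : EuclideanSpace ℝ (Fin 3) := EuclideanSpace.single 1 1

/-- The countermodel datum `U₀(R) = cos(2π R₀) · e₁`. [folklore] -/
def datum (R : EuclideanSpace ℝ (Fin 3)) : EuclideanSpace ℝ (Fin 3) := Real.cos (2 * π * R 0) • e1

/-- `‖A⃗‖ = 1`. [folklore] -/
theorem norm_aVec : ‖aVec‖ = 1 := by
  simp [aVec]

/-- The phase of the countermodel is the third coordinate: `A⃗·R⃗ = R₂`. [folklore] -/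
theorem phase_aVec (R : EuclideanSpace ℝ (Fin 3)) : phase aVec R = R 2 := by
  simp [phase, aVec, EuclideanSpace.inner_single_left]

/-- The coordinate `R ↦ R₀` is smooth (it is the continuous linear map `EuclideanSpace.proj 0`).
[folklore] -/
theorem contDiff_coord0 : ContDiff ℝ ∞ (fun R : EuclideanSpace ℝ (Fin 3) => R 0) :=
  (EuclideanSpace.proj (𝕜 := ℝ) (ι := Fin 3) 0).contDiff

/-- The datum is smooth. [folklore] -/
theorem contDiff_datum : ContDiff ℝ ∞ datum :=
  ((contDiff_const.mul contDiff_coord0).cos).smul contDiff_const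

/-- The derivative of the datum: `DU₀(R) h = (−sin(2π R₀) · 2π h₀) · e₁`. [folklore] -/
theorem hasFDerivAt_datum (R : EuclideanSpace ℝ (Fin 3)) :
    HasFDerivAt datum
      (((-Real.sin (2 * π * R 0)) • ((2 * π) • (EuclideanSpace.proj (𝕜 := ℝ) (ι := Fin 3) 0))).smulRight
        e1) R := by
  have h0 : HasFDerivAt (fun R : EuclideanSpace ℝ (Fin 3) => R 0)
      (EuclideanSpace.proj (𝕜 := ℝ) (ι := Fin 3) 0) R :=
    (EuclideanSpace.proj (𝕜 := ℝ) (ι := Fin 3) 0).hasFDerivAt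
  have h1 : HasFDerivAt (fun R : EuclideanSpace ℝ (Fin 3) => 2 * π * R 0)
      ((2 * π) • (EuclideanSpace.proj (𝕜 := ℝ) (ι := Fin 3) 0)) R := h0.const_mul (2 * π)
  exact h1.cos.smul_const e1

/-- The datum is divergence free: `div U₀ = ∂₁ cos(2π R₀) = 0` (divergence as the trace of `DU₀` in
the standard orthonormal basis). [folklore] -/
theorem isDivFree_datum : NSWave0.IsDivFree datum := fun R => by
  change VectorCalculus.divergence datum R = 0
  rw [divergence_eq_sum_inner_fderiv (EuclideanSpace.basisFun (Fin 3) ℝ), (hasFDerivAt_datum R).fderiv]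
  simp [Fin.sum_univ_three, e1, EuclideanSpace.inner_single_left]

/-- The datum is invariant under the translation by the period vector `A⃗ = e₂` ((2.1.0)/(3.1.4) of the
paper): it does not depend on `R₂`. [folklore] -/
theorem isAPeriodic_datum : IsAPeriodic aVec datum := by
  intro R
  simp [datum, aVec]

/-- The datum satisfies the text's restriction `A⃗·U⃗⁰ ≡ 0` ((3.3.17)–(3.3.18)). [folklore] -/
theorem dataRestriction_datum : DataRestriction aVec datum := by
  intro R
  simp [datum, aVec, e1, inner_smul_right, EuclideanSpace.inner_single_left]

/-- The datum is NOT a function of the single phase `A⃗·R⃗ = R₂`: `R = 0` and `R = ½ e₀` have the same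
phase and different values. [folklore] -/
theorem not_isSinglePhase_datum : ¬ IsSinglePhase aVec datum := by
  rintro ⟨g, hg⟩
  have h0 := hg 0
  have h1 := hg (EuclideanSpace.single 0 (1 / 2 : ℝ))
  rw [phase_aVec] at h0 h1
  have hval0 : datum 0 = e1 := by simp [datum]
  have hval1 : datum (EuclideanSpace.single 0 (1 / 2 : ℝ)) = -e1 := by
    have harg :
        2 * π * ((EuclideanSpace.single (0 : Fin 3) (1 / 2 : ℝ) : EuclideanSpace ℝ (Fin 3)) 0) = π := by
      have hc : ((EuclideanSpace.single (0 : Fin 3) (1 / 2 : ℝ) : EuclideanSpace ℝ (Fin 3)) 0) = 1 / 2 := by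
        simp
      rw [hc]
      ring
    rw [datum, harg, Real.cos_pi, neg_one_smul]
  have hp1 : (EuclideanSpace.single (0 : Fin 3) (1 / 2 : ℝ) : EuclideanSpace ℝ (Fin 3)) 2 = 0 := by
    simp
  rw [hval0] at h0
  rw [hval1, hp1] at h1
  have h00 : (0 : EuclideanSpace ℝ (Fin 3)) 2 = 0 := rfl
  rw [h00] at h0
  have he : e1 = -e1 := h0.trans h1.symm
  have h11 : e1 1 = (-e1) 1 := by rw [← he]
  norm_num [e1] at h11

/-- **`¬ Step 1`** — the single-phase representation (2.1.1)/(2.2.1) fails: a smooth field invariant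
under `R ↦ R + A⃗` need not be a function of `A⃗·R⃗` (witness `A⃗ = e₂`, `U₀ = cos(2π R₀) e₁`).
[folklore] -/
theorem not_Step_1_singlePhase : ¬ Literature.Claims.NS.Petros2018.Step_1_singlePhase := fun h =>
  not_isSinglePhase_datum (h aVec norm_aVec datum contDiff_datum isAPeriodic_datum)

/-- **`¬ ClaimedTheorem`** — the printed claimed statement (every admissible datum has an `A⃗`-periodic
single-phase smooth Navier–Stokes solution) fails for the same datum at `ν = 1`: by the skeleton's
`singlePhase_of_claimed` it would force the datum itself to be single-phase. [folklore] -/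
theorem not_ClaimedTheorem : ¬ Literature.Claims.NS.Petros2018.ClaimedTheorem := fun hc =>
  not_isSinglePhase_datum
    (singlePhase_of_claimed hc one_pos norm_aVec contDiff_datum isDivFree_datum isAPeriodic_datum
      dataRestriction_datum)

/-- Record: with the claimed statement refuted, the printed bridge to the Clay periodic problem (B)
holds vacuously — the chain transmits nothing to (B). [folklore] -/
theorem step_bridge_holds : Literature.Claims.NS.Petros2018.Step_bridge := fun hc =>
  (not_ClaimedTheorem hc).elim

end

end Summit.NavierStokesRegularity.NavierStokesRegularity.Theorems.Petros2018
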